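import Summits.ResolutionOfSingularities.ResolutionOfSingularities.Theorems.MarkedTransferCampaignW46HostSurfacesSNCAt
import Literature.AlgebraicGeometry.Resolution.BlowupSequencesOffCentres
import Literature.AlgebraicGeometry.Resolution.BlowupSequencesExtendOpen
import Summits.ResolutionOfSingularities.ResolutionOfSingularities.Theorems.MarkedTransferCampaignW46ThreefoldsGammaFreeGlobalSNCTransport
import Summits.ResolutionOfSingularities.ResolutionOfSingularities.Theorems.MarkedTransferCampaignW46ThreefoldsGammaFreeGlobalBranchLocal
import Literature.AlgebraicGeometry.Resolution.MonomialOrderReduction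
import Literature.AlgebraicGeometry.Resolution.OrderSemicontinuity
import HarnessLib

/-!
# [OURS · L1 W4.6 rung (i), host words] THE SNC END-GAME IN THE HOST ITEM'S WORDS — once `Supp(I·∏E)` has simple normal
# crossings near `Sing(I, m)`, the marked ideal `(I, E, m)` has a BGMW marked resolution (any dimension)

Cell res-hironaka, LADDER-RESOLUTION rung L (D-0089), slot W4.6, rung (i) SURFACES in the host item's own words
(`CampaignW46.HypersurfaceOrderReductionDimLE p 2`, res-L1-type-o1's host ladder over MarkedTransfer `HypersurfaceOrderReductionDimLeThree`
stmt-ResolutionOfSingularities-16156); seat res-L1-s46-pv-1 (gen 6). `--kind proof --supports` stmt-16156 `--as helper`. Everything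
here is OURS plumbing over the TREE'S monomial resolution of marked ideals (Kollár (3.111) Step 3, `exists_isResolutionOf_monomialMarked`),
boundary equivalence (`BoundaryEquivalence.lean`) and open extension of admissible sequences (`BlowupSequencesExtendOpen.lean`,
`BlowupSequencesOffCentres.lean`); nothing of H. Hironaka's manuscript [Hironaka2017] is asserted. AI-written; AI review is weaker than expert review. Host-words counterpart of
res-L1-s46-pv-11's Γ-free end-game `orderReducible_of_hasSNC_nhds` (p501980).

## What is proved (no definitions)

* `exists_isMarkedResolution_of_isResolutionOf_opens` — **for a marked ideal `M = (X, I, E, μ)` on a locally Noetherian scheme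
  with `E` snc and CLOSED support `supp M ⊆ U` (`U` open), every data-level resolution of the restriction `M|_U` yields a BGMW
  marked resolution of `M`** (any dimension: extend by the tree's `CentreSeq.exists_extend_of_centresOver`, closing up the centres,
  which lie over `supp M` by `IsAdmissibleFor.centresOver_support`; the final support lies over `supp M ⊆ U` and misses the
  preimage of `U`, tree `support_transformMarked_subset_compl_preimage_range`).
* `monomialIdeal_divisorialPoints_of_subset` — an effective Cartier `I ≠ 0` on a regular integral Noetherian scheme is the monomial
  ideal `∏_ζ 𝓘_{cl ζ}^{ord_ζ I}` over the codimension-one points `ζ` of ANY larger closed set `V(J) ⊇ V(I)` (exponent `0` off `V(I)`).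
* `boundaryEquiv_covered_primeDivisors` — on an open `U` where the prime divisors of `J = I·∏E` have simple normal crossings,
  the restricted host boundary `E|_U` is EQUIVALENT (tree `BoundaryEquiv`: same germs through every point) to the list of those
  prime divisors of `J` that lie on members of `E`, restricted to `U`.
* **`exists_isMarkedResolution_of_sncAt_nhds`** — `X` regular integral Noetherian excellent, `I ≠ 0` effective Cartier, `E` an
  snc boundary, `m ≥ 1`, `U` an open set containing `Sing(I, m) = {ord ≥ m}` at every point of which the prime divisors of
  `I·∏E` are snc (`SNCAt`): then `(I, E, m)` HAS A BGMW MARKED RESOLUTION `∃ X′ Φ M′, IsMarkedResolution ⟨I, E, m⟩ Φ M′` —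
  Kollár's monomial resolution of `(I|_U, prime divisors|_U, m)` is a resolution for the sub-boundary of the covered prime
  divisors, hence for the equivalent boundary `E|_U`, and extends from `U ⊇ Sing(I, m)` to `X`.

## Sources

* J. Kollár, *Lectures on Resolution of Singularities* (2007), (3.111) Step 3; Thm. 3.105. [Kollar2007]
* E. Bierstone, D. Grigoriev, P. Milman, J. Włodarczyk, arXiv:1206.3090, Def. 3.1.1–3.1.5, §4 Step 1a/2b. [BierstoneGrigorievMilmanWlodarczyk2011]
* V. Cossart, O. Piltant, J. Algebra 320 (2008), proof of Prop. 4.2 (divisorial decomposition). [CossartPiltant2008]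
* H. Hironaka, ms. 2017-03-23 — scope only, under adjudication, not cited as fact. [Hironaka2017]
-/

noncomputable section

set_option linter.dupNamespace false -- mandated namespace of this single-conjunct summit

open CategoryTheory AlgebraicGeometry TopologicalSpace IsLocalRing

namespace Summit.ResolutionOfSingularities.ResolutionOfSingularities.Theorems

namespace CampaignW46

open Literature.AlgebraicGeometry.Resolution
open Scheme.IdealSheafData

universe u

/-! ## §0 Marked resolutions from resolutions on an open neighbourhood of the support -/

/-- **A BGMW MARKED RESOLUTION MAY BE BUILT ON AN OPEN NEIGHBOURHOOD OF THE (CLOSED) SUPPORT.** `X` locally Noetherian,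
`M = (X, I, E, μ)` a marked ideal with `E` snc and `supp M` closed, `U ⊆ X` open with `supp M ⊆ U`; if the restriction
`M|_U = (U, I|_U, E|_U, μ)` has a data-level resolution `s` (`CentreSeq.IsResolutionOf`), then `M` has a marked resolution
`∃ X′ (Φ : X′ ⟶ X) M′, IsMarkedResolution M Φ M′`: the centres of `s` lie over `supp M` (tree
`IsAdmissibleFor.centresOver_support`), hence are closed in the towers over `X`, so `s` extends to a multiple blow-up `t` of `M`
blowing up the same centres (tree `CentreSeq.exists_extend_of_centresOver`); the final support along `t` lies over `supp M ⊆ U`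
(tree `IsAdmissibleFor.support_transformMarked_subset_preimage`) and misses the preimage of `U` (tree
`support_transformMarked_subset_compl_preimage_range`), so it is empty. Any dimension.
[cite: BierstoneGrigorievMilmanWlodarczyk2011, Def. 3.1.5 Remark (1), Thm. 8.0.5 (2)] [cite: Kollar2007, Thm. 3.105 (proof)] -/
theorem exists_isMarkedResolution_of_isResolutionOf_opens {X : Scheme.{u}} [IsLocallyNoetherian X] (M : MarkedIdeal X) (hE : HasSNC M.boundary)
    (hclosed : IsClosed M.support) (U : X.Opens) (hU : M.support ⊆ (U : Set X)) {s : CentreSeq (U : Scheme.{u})}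
    (hs : s.IsResolutionOf (M.comap U.ι)) :
    ∃ (X' : Scheme.{u}) (Φ : X' ⟶ X) (M' : MarkedIdeal X'), IsMarkedResolution M Φ M' := by
  haveI : IsLocallyNoetherian (U : Scheme.{u}) := LocallyOfFiniteType.isLocallyNoetherian U.ι
  have hrange : M.support ⊆ Set.range U.ι := by rw [Scheme.Opens.range_ι]; exact hU
  have hover : s.CentresOver (U.ι ⁻¹' M.support) := by
    have h := CentreSeq.IsAdmissibleFor.centresOver_support s _ hs.1
    rwa [MarkedIdeal.support_comap_of_isOpenImmersion] at h
  obtain ⟨t, htadm, -, hpb⟩ := CentreSeq.exists_extend_of_centresOver s U.ι M M.support hclosed hrange hE hs.1 hover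
  refine ⟨t.top, t.comp, t.transformMarked M, CentreSeq.IsResolutionOf.isMarkedResolution ⟨htadm, ?_⟩⟩
  have h1 := CentreSeq.IsAdmissibleFor.support_transformMarked_subset_preimage t M htadm
  have h2 := CentreSeq.support_transformMarked_subset_compl_preimage_range t U.ι M hpb hs
  ext z
  simp only [Set.mem_empty_iff_false, iff_false]
  exact fun hz => h2 hz (hrange (h1 hz))

variable {X : Scheme.{u}} [IsIntegral X] [AlgebraicGeometry.IsNoetherian X]

/-! ## §1 `I` as a monomial over the prime divisors of a larger closed set -/

/-- **`I = ∏_{ζ ∈ T} 𝓘_{cl ζ}^{ord_ζ I}` for every finite set `T` of codimension-one points containing those of `V(I)`**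
(`I ≠ 0` locally principal on a regular integral Noetherian scheme; the extra factors have exponent `ord_ζ I = 0`).
[cite: CossartPiltant2008, proof of Prop. 4.2] -/
theorem monomialIdeal_divisorialPoints_of_subset (hX : Scheme.IsRegular X) {I : X.IdealSheafData} (hI : I ≠ ⊥)
    (hIp : IsLocallyPrincipal I) (T : Finset X) (hT : ∀ ζ, ζ ∈ T → Order.coheight ζ = 1)
    (hIT : divisorialPoints I ⊆ T) :
    monomialIdeal (T.toList.map fun ζ => (primeDivisorIdeal ζ, (idealOrder I ζ).toNat)) = I := by
  classical
  have h1 : monomialIdeal (T.toList.map fun ζ => (primeDivisorIdeal ζ, (idealOrder I ζ).toNat)) =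
      ∏ ζ ∈ T, primeDivisorIdeal ζ ^ (idealOrder I ζ).toNat := by
    rw [monomialIdeal, List.map_map, Finset.prod_map_toList]; rfl
  have h2 : I = ∏ ζ ∈ (finite_divisorialPoints hI).toFinset, primeDivisorIdeal ζ ^ (idealOrder I ζ).toNat := by
    conv_lhs => rw [eq_monomialIdeal_divisorial hX hI hIp]
    rw [monomialIdeal, List.map_map, Finset.prod_map_toList]; rfl
  have hsub : (finite_divisorialPoints hI).toFinset ⊆ T := fun ζ hζ => hIT ((Set.Finite.mem_toFinset _).mp hζ)
  have h3 : ∏ ζ ∈ (finite_divisorialPoints hI).toFinset, primeDivisorIdeal ζ ^ (idealOrder I ζ).toNat =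
      ∏ ζ ∈ T, primeDivisorIdeal ζ ^ (idealOrder I ζ).toNat := by
    refine Finset.prod_subset hsub fun ζ hζT hζ => ?_
    have hζ' : ζ ∉ I.support := fun h => hζ ((Set.Finite.mem_toFinset _).mpr ⟨h, hT ζ hζT⟩)
    have h0 : idealOrder I ζ = 0 := by
      have h := (mem_support_iff_one_le_idealOrder I ζ).not.mp hζ'
      rw [not_le] at h
      obtain ⟨n, hn⟩ := ENat.ne_top_iff_exists.mp (idealOrder_ne_top hI ζ)
      rw [← hn] at h ⊢
      have : n < 1 := by exact_mod_cast h
      simp [show n = 0 by omega]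
    rw [h0, ENat.toNat_zero, pow_zero]
  rw [h1, ← h3, ← h2]

/-! ## §2 The host boundary is equivalent, near the snc points, to the covered prime divisors -/

/-- The germ at `x` of a member `D₀` of an snc boundary containing the codimension-one point `ζ ⤳ x` of `V(J)`, `J ≤ D₀`,
is the germ of the prime divisor `𝓘_{cl ζ}` (both are the germ of the branch of `D₀` through `x`). [folklore] -/
theorem stalkIdeal_primeDivisorIdeal_eq_of_mem_support (hX : Scheme.IsRegular X) {E : List X.IdealSheafData}
    (hE : HasSNC E) {J : X.IdealSheafData} (hJ : J ≠ ⊥) (hJp : IsLocallyPrincipal J) {D₀ : X.IdealSheafData} (hD₀ : D₀ ∈ E)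
    (hJD : J ≤ D₀) {ζ : X} (hζ : ζ ∈ divisorialPoints J) (hζD : ζ ∈ D₀.support) {x : X} (hx : ζ ⤳ x) :
    stalkIdeal (primeDivisorIdeal ζ) x = stalkIdeal D₀ x := by
  have hxD : x ∈ D₀.support := D₀.support.isClosed.closure_subset_iff.mpr (Set.singleton_subset_iff.mpr hζD)
    (specializes_iff_mem_closure.mp hx)
  obtain ⟨ζ', hζ', hx', -, heq⟩ := exists_branch_stalkIdeal_eq_of_le hX hE hJ hJp hD₀ hJD hxD
  -- `D₀ ≤ 𝓘_{cl ζ}` (`D₀` is the radical ideal of its support, which contains `cl ζ`)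
  have hle : D₀ ≤ primeDivisorIdeal ζ := by
    rw [← HasSNCWith.vanishingIdeal_support hE hD₀, primeDivisorIdeal]
    exact Scheme.IdealSheafData.vanishingIdeal_antimono
      (D₀.support.isClosed.closure_subset_iff.mpr (Set.singleton_subset_iff.mpr hζD))
  have hsp : ζ' ⤳ ζ := eq_of_stalkIdeal_primeDivisorIdeal_le hx' hx (heq ▸ stalkIdeal_mono hle x)
  have hζζ' : ζ' = ζ := by
    by_contra hne
    exact not_specializes_of_coheight_eq_one ((mem_divisorialPoints_iff J ζ').mp hζ').2
      ((mem_divisorialPoints_iff J ζ).mp hζ).2 hne hsp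
  rw [← hζζ', heq]

/-- **The restricted host boundary is equivalent to the covered prime divisors of `J = I·∏E`.** `X` regular integral
Noetherian, `E` an snc boundary, `J ≠ 0` locally principal with `J ≤ D` for all `D ∈ E`, `T` the finite set of codimension-one
points of `V(J)`, `U ⊆ X` open. Let `B` be the list of the `𝓘_{cl ζ}`, `ζ ∈ T` lying on some member of `E` ("covered"),
restricted to `U`. Then `BoundaryEquiv B (E|_U)` (tree `BoundaryEquiv`: through every point of `U` the two lists have the same
germs, and each is stalk-injective). [cite: BierstoneGrigorievMilmanWlodarczyk2011, Def. 3.1.1] -/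
theorem boundaryEquiv_covered_primeDivisors (hX : Scheme.IsRegular X) {E : List X.IdealSheafData} (hE : HasSNC E)
    {J : X.IdealSheafData} (hJ : J ≠ ⊥) (hJp : IsLocallyPrincipal J) (hEJ : ∀ D ∈ E, J ≤ D) (U : X.Opens)
    (Tc : List X) (hTc : ∀ ζ, ζ ∈ Tc ↔ ζ ∈ divisorialPoints J ∧ ∃ D ∈ E, ζ ∈ D.support) :
    BoundaryEquiv (Tc.map fun ζ => (primeDivisorIdeal ζ).comap U.ι) (E.map fun D => D.comap U.ι) := by
  haveI : IsLocallyNoetherian X := inferInstance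
  have hEU : HasSNC (E.map fun D => D.comap U.ι) := by
    have h := HasSNCWith.comap_of_etale U.ι hE
    rwa [Scheme.IdealSheafData.comap_top] at h
  -- stalks on `U` are images of stalks on `X` under the stalk isomorphisms of `U.ι`
  have hst : ∀ (K : X.IdealSheafData) (u : U), stalkIdeal (K.comap U.ι) u = (stalkIdeal K (U.ι u)).map (U.ι.stalkMap u).hom :=
    fun K u => stalkIdeal_comap_eq_map_stalkMap U.ι K u
  have hinj : ∀ (u : U) (K K' : X.IdealSheafData),
      stalkIdeal (K.comap U.ι) u = stalkIdeal (K'.comap U.ι) u → stalkIdeal K (U.ι u) = stalkIdeal K' (U.ι u) := by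
    intro u K K' h
    rw [hst, hst] at h
    have hb : Function.Bijective (U.ι.stalkMap u).hom := ConcreteCategory.bijective_of_isIso (U.ι.stalkMap u)
    rw [← Ideal.comap_map_of_bijective (U.ι.stalkMap u).hom hb (I := stalkIdeal K (U.ι u)), h,
      Ideal.comap_map_of_bijective (U.ι.stalkMap u).hom hb]
  have hsupp : ∀ (K : X.IdealSheafData) (u : U), u ∈ (K.comap U.ι).support ↔ U.ι u ∈ K.support := fun K u => by
    rw [Scheme.IdealSheafData.support_comap]; rfl
  intro u
  refine ⟨?_, ?_, ?_, hEU.injOn_stalkIdeal u⟩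
  · -- covered prime divisors have a partner in `E`
    intro D₁ hD₁ hu
    obtain ⟨ζ, hζ, rfl⟩ := List.mem_map.mp hD₁
    obtain ⟨hζJ, D₀, hD₀, hζD⟩ := (hTc ζ).mp hζ
    have hx : ζ ⤳ U.ι u := (mem_support_primeDivisorIdeal_iff ζ _).mp ((hsupp _ u).mp hu)
    have heq := stalkIdeal_primeDivisorIdeal_eq_of_mem_support hX hE hJ hJp hD₀ (hEJ D₀ hD₀) hζJ hζD hx
    refine ⟨D₀.comap U.ι, List.mem_map.mpr ⟨D₀, hD₀, rfl⟩, ?_, ?_⟩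
    · refine (hsupp D₀ u).mpr ?_
      rw [mem_support_iff_stalkIdeal_le, ← heq, ← mem_support_iff_stalkIdeal_le]
      exact (mem_support_primeDivisorIdeal_iff ζ _).mpr hx
    · rw [hst, hst, heq]
  · -- members of `E` have a covered prime-divisor partner
    intro D₂ hD₂ hu
    obtain ⟨D₀, hD₀, rfl⟩ := List.mem_map.mp hD₂
    have hxD : U.ι u ∈ D₀.support := (hsupp _ u).mp hu
    obtain ⟨ζ, hζJ, hx, hζD, heq⟩ := exists_branch_stalkIdeal_eq_of_le hX hE hJ hJp hD₀ (hEJ D₀ hD₀) hxD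
    refine ⟨(primeDivisorIdeal ζ).comap U.ι, List.mem_map.mpr ⟨ζ, (hTc ζ).mpr ⟨hζJ, D₀, hD₀, hζD⟩, rfl⟩, ?_, ?_⟩
    · exact (hsupp _ u).mpr ((mem_support_primeDivisorIdeal_iff ζ _).mpr hx)
    · rw [hst, hst, heq]
  · -- the covered prime divisors are stalk-injective
    intro D hD D' hD' hu hu' heq
    obtain ⟨ζ, hζ, rfl⟩ := List.mem_map.mp hD
    obtain ⟨ζ', hζ', rfl⟩ := List.mem_map.mp hD'
    have hx : ζ ⤳ U.ι u := (mem_support_primeDivisorIdeal_iff ζ _).mp ((hsupp _ u).mp hu)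
    have hx' : ζ' ⤳ U.ι u := (mem_support_primeDivisorIdeal_iff ζ' _).mp ((hsupp _ u).mp hu')
    have h := hinj u _ _ heq
    have h1 : ζ ⤳ ζ' := eq_of_stalkIdeal_primeDivisorIdeal_le hx hx' h.le
    have hc := ((mem_divisorialPoints_iff J ζ).mp ((hTc ζ).mp hζ).1).2
    have hc' := ((mem_divisorialPoints_iff J ζ').mp ((hTc ζ').mp hζ').1).2
    by_cases hne : ζ = ζ'
    · rw [hne]
    · exact absurd h1 (not_specializes_of_coheight_eq_one hc hc' hne)

/-! ## §3 The end-game -/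

/-- **THE SNC END-GAME OF THE SURFACE RUNG, IN THE HOST ITEM'S WORDS (any dimension).** Let `X` be a regular integral
Noetherian excellent scheme, `I ≠ 0` an effective Cartier ideal, `E` an snc boundary (`HasSNC E`), `m ≥ 1`, and `U ⊆ X` an
open set containing `Sing(I, m) = {x | m ≤ ord_x I}` such that at every point of `U` the list of prime divisors `𝓘_{cl ζ}` of
`V(I · ∏_{D ∈ E} D)` is snc (`SNCAt`). Then the marked ideal `(I, E, m)` has a BGMW marked resolution:
`∃ X′ (Φ : X′ ⟶ X) M′, IsMarkedResolution ⟨I, E, m⟩ Φ M′`. Proof: on `U`, `I|_U` is the monomial ideal of the restricted prime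
divisors of `J = I·∏E` (exponents `ord_ζ I`), whose boundary is snc; Kollár's monomial resolution (tree
`exists_isResolutionOf_monomialMarked`) resolves `(I|_U, all prime divisors|_U, m)`, hence `(I|_U, covered prime divisors|_U, m)`
(sub-boundary), hence `(I|_U, E|_U, m)` (equivalent boundary, `boundaryEquiv_covered_primeDivisors`), and this resolution extends
from `U ⊇ Sing(I, m)` to `X` (`exists_isMarkedResolution_of_isResolutionOf_opens`). [cite: Kollar2007, (3.111) Step 3]
[cite: BierstoneGrigorievMilmanWlodarczyk2011, Def. 3.1.3] -/
theorem exists_isMarkedResolution_of_sncAt_nhds (hX : Scheme.IsRegular X) (hXe : Scheme.IsExcellent X)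
    {I : X.IdealSheafData} (hI : I ≠ ⊥) (hIc : IsEffectiveCartier I) {E : List X.IdealSheafData} (hE : HasSNC E)
    {m : ℕ} (hm : 1 ≤ m) (hJ : I * E.prod ≠ ⊥) (U : X.Opens) (hU : ∀ x : X, (m : ℕ∞) ≤ idealOrder I x → x ∈ (U : Set X))
    (hsnc : ∀ y ∈ (U : Set X), SNCAt (((finite_divisorialPoints hJ).toFinset.toList).map primeDivisorIdeal) y) :
    ∃ (X' : Scheme.{u}) (Φ : X' ⟶ X) (M' : MarkedIdeal X'), IsMarkedResolution (⟨I, E, m⟩ : MarkedIdeal X) Φ M' := by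
  classical
  haveI : IsLocallyNoetherian X := inferInstance
  haveI : IsLocallyNoetherian (U : Scheme.{u}) := LocallyOfFiniteType.isLocallyNoetherian U.ι
  set J := I * E.prod with hJdef
  have hJc : IsEffectiveCartier J := hIc.mul (HasSNC.isEffectiveCartier_prod hE)
  have hJp : IsLocallyPrincipal J := hJc.isLocallyPrincipal
  have hEJ : ∀ D ∈ E, J ≤ D := fun D hD =>
    le_trans (mul_le_of_le_one_left bot_le le_top) (IdealSheafData.prod_le_of_mem hD)
  set T := (finite_divisorialPoints hJ).toFinset with hT
  have hTmem : ∀ ζ, ζ ∈ T ↔ ζ ∈ divisorialPoints J := fun ζ => by simp [hT]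
  -- §A the monomial presentation of `I|_U` over the prime divisors of `J`
  set Ea : List ((U : Scheme.{u}).IdealSheafData × ℕ) :=
    T.toList.map fun ζ => ((primeDivisorIdeal ζ).comap U.ι, (idealOrder I ζ).toNat) with hEa
  have hEaX : Ea = (T.toList.map fun ζ => (primeDivisorIdeal ζ, (idealOrder I ζ).toNat)).map
      fun p => (p.1.comap U.ι, p.2) := by rw [hEa, List.map_map]; rfl
  have hbdry : boundaryOf Ea = (T.toList.map primeDivisorIdeal).map fun D => D.comap U.ι := by
    rw [hEa, boundaryOf, List.map_map, List.map_map]; rfl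
  have hideal : monomialIdeal Ea = I.comap U.ι := by
    rw [hEaX, ← comap_monomialIdeal_eq, monomialIdeal_divisorialPoints_of_subset hX hI hIc.isLocallyPrincipal T
      (fun ζ hζ => ((mem_divisorialPoints_iff J ζ).mp ((hTmem ζ).mp hζ)).2) ?_]
    intro ζ hζ
    rw [Finset.mem_coe, hTmem, mem_divisorialPoints_iff]
    obtain ⟨hζs, hζc⟩ := (mem_divisorialPoints_iff I ζ).mp hζ
    exact ⟨Scheme.IdealSheafData.support_antitone (mul_le_of_le_one_right bot_le le_top : J ≤ I) hζs, hζc⟩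
  have hEasnc : HasSNC (boundaryOf Ea) := by
    rw [hbdry]
    exact hasSNC_map_comap_ι_of_forall_sncAt _ U hsnc
  -- §B Kollár's monomial resolution on `U`, read for the covered sub-boundary, then for `E|_U`
  obtain ⟨s, hs⟩ := exists_isResolutionOf_monomialMarked Ea hEasnc hm
  have hs1 : s.IsResolutionOf ⟨I.comap U.ι, boundaryOf Ea, m⟩ := by
    rw [← hideal]; exact hs
  set Tc : List X := T.toList.filter fun ζ => ∃ D ∈ E, ζ ∈ D.support with hTc
  have hTcmem : ∀ ζ, ζ ∈ Tc ↔ ζ ∈ divisorialPoints J ∧ ∃ D ∈ E, ζ ∈ D.support := fun ζ => by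
    rw [hTc, List.mem_filter, Finset.mem_toList, hTmem, decide_eq_true_iff]
  have hsub : (Tc.map fun ζ => (primeDivisorIdeal ζ).comap U.ι).Sublist (boundaryOf Ea) := by
    rw [hbdry, List.map_map]
    exact List.Sublist.map _ List.filter_sublist
  have hs2 : s.IsResolutionOf ⟨I.comap U.ι, Tc.map fun ζ => (primeDivisorIdeal ζ).comap U.ι, m⟩ :=
    CentreSeq.IsResolutionOf.of_boundary_sublist s hsub hs1
  have hs3 : s.IsResolutionOf ((⟨I, E, m⟩ : MarkedIdeal X).comap U.ι) :=
    CentreSeq.IsResolutionOf.of_boundaryEquiv s (boundaryEquiv_covered_primeDivisors hX hE hJ hJp hEJ U Tc hTcmem) hs2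
  -- §C extend from `U ⊇ Sing(I, m)` to `X`
  exact exists_isMarkedResolution_of_isResolutionOf_opens ⟨I, E, m⟩ hE (isClosed_setOf_le_idealOrder hX hXe hI m) U
    (fun x hx => hU x hx) hs3

end CampaignW46

end Summit.ResolutionOfSingularities.ResolutionOfSingularities.Theorems

end
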